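import Summits.Ventures.LatticeQCDFlow.Scoring.SU3TorusHaarAngles
import Summits.Ventures.LatticeQCDFlow.Scoring.OnePlaquetteSU3Bessel
import Summits.Ventures.LatticeQCDFlow.Scoring.OnePlaquetteSU3Enclosures
import Summits.Ventures.LatticeQCDFlow.Scoring.OnePlaquetteSU3PlaquetteBessel
import Summits.Ventures.LatticeQCDFlow.Scoring.OnePlaquetteSU3FreeEnergy
import Summits.Ventures.LatticeQCDFlow.Scaling.LatticePeeling
import Literature.RepresentationTheory.CompactGroups.WeylIntegralFormula
import HarnessLib

/-!
# SU(3): Weyl's integral formula (named fact) ⟹ theory-2's Haar one-plaquette law IS row 5's Weyl-torus law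

HONEST FRAMING: exact (Metropolis-corrected) sampling algorithms for lattice gauge theory;
figures of merit are autocorrelation/cost numbers at stated couplings and volumes; no
continuum-physics claim.

Venture `LatticeQCDFlow` (cell pub-lqcd), sub-topic `Scoring`; FANOUT row 5 (`s0-sun-a`), GEN-16.
NEW WORK of the cell (placement rule); part 2 of the Haar bridge (part 1: `SU3TorusHaarAngles.lean`).
Every theorem here is CONDITIONAL on the tree's named fact
`hW : Literature.RepresentationTheory.CompactGroups.weylIntegralFormula_specialUnitary (Fin 3)` —
Weyl's integral formula for `SU(3)` in pushforward form (Bröcker–tom Dieck, GTM 98, IV (1.11); the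
tree proves it for `Fin 2` in `Exactness/WeylIntegralFormulaSU2.lean` and is discharging the `U(n)`
version in `Literature/RepresentationTheory/CompactGroups/WeylIntegration*.lean`; when the `SU(3)` case
lands, `hW` is supplied by that theorem and everything below is unconditional).  This is the `SU(3)`
counterpart of GEN-9's UNCONDITIONAL `SU2HaarClassAngle.lean` (`z₁^{SU(2)}(β) = e^{−2β} I₁(2β)/β`,
Haar plaquette `= I₂(2β)/I₁(2β)`):

* §4 **`integral_haar_su3_classFun_eq_integral2`** — for continuous conjugation-invariant `F` on
  matrices, `∫_{SU(3)} F dU = (1/(6(2π)²)) ∫_0^{2π}∫_0^{2π} F(diag(e^{iθ₁}, e^{iθ₂}, e^{−i(θ₁+θ₂)})) |Δ|² dθ`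
  (pushforward ⟹ `∫_{SU(3)×SΔ(3)} F(g t g⁻¹)` ⟹ class property ⟹ Fubini ⟹ density ⟹ part 1's torus
  formula ⟹ periodic shift; `|Δ|² = weylSU3` by `vandermonde_su3Diag_eq_weylSU3`);
  `integral_haar_su3_traceFun_eq_integral2` — the case `F = g(Re tr U)`, `Re tr = reTrSU3`;
* §5 **`z1_su3_eq_onePlaquetteZSU3`** — theory-2's one-plaquette integral
  `z₁(β) = ∫ e^{−β(3 − Re tr U)} dU = e^{−3β} Z₃(3β)/(6(2π)²)` (dictionary `β_table = 3β`);
  **`z1_su3_eq_tsum_det`** — with GEN-16's `OnePlaquetteSU3Bessel`: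
  `z₁(β) = e^{−3β} Σ_{q ∈ ℤ} det[I_{|q+i−j|}(β)]_{i,j<3}`;
  **`haar_su3_expect_eq_onePlaquetteExpectSU3`** / **`haar_su3_plaquette_eq`** — the Haar one-plaquette
  expectation of any continuous function of `Re tr U`, in particular the plaquette `⟨(1/3) Re tr U_p⟩`,
  is GEN-6's `onePlaquetteExpectSU3 (3β)`; hence **`haar_su3_plaquette_encl_five_thirds`** — the
  kernel enclosure `0.353954436705 ≤ ⟨plaq⟩ ≤ 0.353954436706` at theory-2 coupling `5/3` (table `β = 5`,
  the S0-C point) now read on the Haar measure, conditionally on `hW`; likewise the Bessel–Toeplitz form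
  of the Haar plaquette (`haar_su3_plaquette_eq_tsum_det`, arguments `β`) and its monotonicity in `β`
  (`haar_su3_plaquette_monotone`).

So, modulo exactly one named published theorem, every SU(3) one-plaquette statement of row 5
(Bessel–Toeplitz forms, enclosures at `β = 4, 5, 6`, variance, monotonicity) is a statement about the
Haar-measure lattice model of theory 2.  Nothing is cited as a fact beyond `hW`; no `def`.
-/

noncomputable section

open Real MeasureTheory Finset
open Literature.MathematicalPhysics.QuantumFieldTheory (haarProbability)
open Literature.MathematicalPhysics.QuantumFieldTheory.CircleHaar (integral_pi_haarProbability_circle)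
open Literature.MathematicalPhysics.QuantumLattice
open Literature.Analysis.FunctionSpaces (besselI)
open Literature.LinearAlgebra.Matrix
open Literature.RepresentationTheory.CompactGroups
open Summit.Ventures.LatticeQCDFlow.Exactness

namespace Summit.Ventures.LatticeQCDFlow.Scoring

/-! ### 4. Weyl's integral formula for `SU(3)` (the tree's named fact) ⟹ class functions integrate over eigen-angles -/

/-- **Class functions on `SU(3)` integrate over the eigen-angles against the Weyl density**
(CONDITIONAL on the tree's named fact `weylIntegralFormula_specialUnitary (Fin 3)` —
Bröcker–tom Dieck IV (1.11) for `SU(3)` in pushforward form, proved in the tree for `Fin 2` only):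
for a continuous `F` on matrices that is invariant under `SU(3)`-conjugation,
`∫_{SU(3)} F(U) dU = (1/(6(2π)²)) ∫_0^{2π}∫_0^{2π} F(diag(e^{iθ₁}, e^{iθ₂}, e^{−i(θ₁+θ₂)})) |Δ|²(θ₁,θ₂) dθ₂ dθ₁`
(`|Δ|² = weylSU3`; `6 = |W(SU(3))| = 3!`, `(2π)⁻²` = the Haar probability of the torus in angles). -/
theorem integral_haar_su3_classFun_eq_integral2 (hW : weylIntegralFormula_specialUnitary (Fin 3))
    (F : Matrix (Fin 3) (Fin 3) ℂ → ℝ) (hF : Continuous F)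
    (hcl : ∀ g U : Matrix.specialUnitaryGroup (Fin 3) ℂ,
      F (((g * U * g⁻¹ : Matrix.specialUnitaryGroup (Fin 3) ℂ)) : Matrix (Fin 3) (Fin 3) ℂ)
        = F ((U : Matrix.specialUnitaryGroup (Fin 3) ℂ) : Matrix (Fin 3) (Fin 3) ℂ)) :
    ∫ U, F ((U : Matrix.specialUnitaryGroup (Fin 3) ℂ) : Matrix (Fin 3) (Fin 3) ℂ)
        ∂(haarProbability (Matrix.specialUnitaryGroup (Fin 3) ℂ))
      = 1 / (6 * (2 * π) ^ 2) * ∫ θ₁ in (0 : ℝ)..2 * π, ∫ θ₂ in (0 : ℝ)..2 * π,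
          F (Matrix.diagonal ![Complex.exp ((θ₁ : ℂ) * Complex.I), Complex.exp ((θ₂ : ℂ) * Complex.I),
            Complex.exp (((-(θ₁ + θ₂) : ℝ) : ℂ) * Complex.I)]) * weylSU3 θ₁ θ₂ := by
  -- the Vandermonde weight as a function of the matrix, and the weighted class function `K`
  set V : Matrix (Fin 3) (Fin 3) ℂ → ℝ := fun M => ∏ i, ∏ j ∈ univ.erase i, ‖M i i - M j j‖ with hV
  have hVc : Continuous V := by
    simp only [hV]
    exact continuous_finsetProd _ fun i _ => continuous_finsetProd _ fun j _ =>
      ((continuous_apply_apply i i).sub (continuous_apply_apply j j)).norm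
  have hV0 : ∀ M, 0 ≤ V M := fun M =>
    Finset.prod_nonneg fun i _ => Finset.prod_nonneg fun j _ => norm_nonneg _
  set K : Matrix (Fin 3) (Fin 3) ℂ → ℝ := fun M => V M / 6 * F M with hK
  have hKc : Continuous K := (hVc.div_const 6).mul hF
  have hFm : Continuous fun U : Matrix.specialUnitaryGroup (Fin 3) ℂ =>
      F ((U : Matrix.specialUnitaryGroup (Fin 3) ℂ) : Matrix (Fin 3) (Fin 3) ℂ) :=
    hF.comp continuous_subtype_val
  have hW' := hW
  unfold weylIntegralFormula_specialUnitary at hW'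
  -- Step 1–4: pushforward, class property, Fubini, density
  have hstep : ∫ U, F ((U : Matrix.specialUnitaryGroup (Fin 3) ℂ) : Matrix (Fin 3) (Fin 3) ℂ)
        ∂(haarProbability (Matrix.specialUnitaryGroup (Fin 3) ℂ))
      = ∫ t, K (((t : specialDiagonalTorus (Fin 3)) : Matrix.specialUnitaryGroup (Fin 3) ℂ) :
          Matrix (Fin 3) (Fin 3) ℂ) ∂(haarProbability (specialDiagonalTorus (Fin 3))) := by
    calc ∫ U, F ((U : Matrix.specialUnitaryGroup (Fin 3) ℂ) : Matrix (Fin 3) (Fin 3) ℂ)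
          ∂(haarProbability (Matrix.specialUnitaryGroup (Fin 3) ℂ))
        = ∫ U, F ((U : Matrix.specialUnitaryGroup (Fin 3) ℂ) : Matrix (Fin 3) (Fin 3) ℂ)
          ∂(Measure.map (fun q : Matrix.specialUnitaryGroup (Fin 3) ℂ × specialDiagonalTorus (Fin 3) =>
              q.1 * (q.2 : Matrix.specialUnitaryGroup (Fin 3) ℂ) * q.1⁻¹)
            ((haarProbability (Matrix.specialUnitaryGroup (Fin 3) ℂ)).prod
              ((haarProbability (specialDiagonalTorus (Fin 3))).withDensity fun t => ENNReal.ofReal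
                ((∏ i, ∏ j ∈ Finset.univ.erase i,
                  ‖((t : Matrix.specialUnitaryGroup (Fin 3) ℂ) : Matrix (Fin 3) (Fin 3) ℂ) i i -
                    ((t : Matrix.specialUnitaryGroup (Fin 3) ℂ) : Matrix (Fin 3) (Fin 3) ℂ) j j‖) /
                  (Fintype.card (Fin 3)).factorial)))) := by rw [hW']
      _ = ∫ q : Matrix.specialUnitaryGroup (Fin 3) ℂ × specialDiagonalTorus (Fin 3),
            F (((q.1 * (q.2 : Matrix.specialUnitaryGroup (Fin 3) ℂ) * q.1⁻¹ :
              Matrix.specialUnitaryGroup (Fin 3) ℂ)) : Matrix (Fin 3) (Fin 3) ℂ)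
          ∂((haarProbability (Matrix.specialUnitaryGroup (Fin 3) ℂ)).prod
              ((haarProbability (specialDiagonalTorus (Fin 3))).withDensity fun t => ENNReal.ofReal
                ((∏ i, ∏ j ∈ Finset.univ.erase i,
                  ‖((t : Matrix.specialUnitaryGroup (Fin 3) ℂ) : Matrix (Fin 3) (Fin 3) ℂ) i i -
                    ((t : Matrix.specialUnitaryGroup (Fin 3) ℂ) : Matrix (Fin 3) (Fin 3) ℂ) j j‖) /
                  (Fintype.card (Fin 3)).factorial))) :=
          integral_map measurable_conjChart_special.aemeasurable hFm.aestronglyMeasurable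
      _ = ∫ q : Matrix.specialUnitaryGroup (Fin 3) ℂ × specialDiagonalTorus (Fin 3),
            F (((q.2 : Matrix.specialUnitaryGroup (Fin 3) ℂ)) : Matrix (Fin 3) (Fin 3) ℂ)
          ∂((haarProbability (Matrix.specialUnitaryGroup (Fin 3) ℂ)).prod
              ((haarProbability (specialDiagonalTorus (Fin 3))).withDensity fun t => ENNReal.ofReal
                ((∏ i, ∏ j ∈ Finset.univ.erase i,
                  ‖((t : Matrix.specialUnitaryGroup (Fin 3) ℂ) : Matrix (Fin 3) (Fin 3) ℂ) i i -
                    ((t : Matrix.specialUnitaryGroup (Fin 3) ℂ) : Matrix (Fin 3) (Fin 3) ℂ) j j‖) /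
                  (Fintype.card (Fin 3)).factorial))) := by
          congr 1
          funext q
          exact hcl q.1 q.2
      _ = ∫ t, F (((t : specialDiagonalTorus (Fin 3)) : Matrix.specialUnitaryGroup (Fin 3) ℂ) :
            Matrix (Fin 3) (Fin 3) ℂ)
          ∂((haarProbability (specialDiagonalTorus (Fin 3))).withDensity fun t => ENNReal.ofReal
                ((∏ i, ∏ j ∈ Finset.univ.erase i,
                  ‖((t : Matrix.specialUnitaryGroup (Fin 3) ℂ) : Matrix (Fin 3) (Fin 3) ℂ) i i -
                    ((t : Matrix.specialUnitaryGroup (Fin 3) ℂ) : Matrix (Fin 3) (Fin 3) ℂ) j j‖) /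
                  (Fintype.card (Fin 3)).factorial)) := by
          have h := integral_fun_snd (μ := haarProbability (Matrix.specialUnitaryGroup (Fin 3) ℂ))
            (ν := (haarProbability (specialDiagonalTorus (Fin 3))).withDensity fun t => ENNReal.ofReal
                ((∏ i, ∏ j ∈ Finset.univ.erase i,
                  ‖((t : Matrix.specialUnitaryGroup (Fin 3) ℂ) : Matrix (Fin 3) (Fin 3) ℂ) i i -
                    ((t : Matrix.specialUnitaryGroup (Fin 3) ℂ) : Matrix (Fin 3) (Fin 3) ℂ) j j‖) /
                  (Fintype.card (Fin 3)).factorial))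
            (fun t : specialDiagonalTorus (Fin 3) =>
              F (((t : Matrix.specialUnitaryGroup (Fin 3) ℂ)) : Matrix (Fin 3) (Fin 3) ℂ))
          rw [probReal_univ, one_smul] at h
          exact h
      _ = ∫ t, (ENNReal.ofReal ((∏ i, ∏ j ∈ Finset.univ.erase i,
                  ‖((t : Matrix.specialUnitaryGroup (Fin 3) ℂ) : Matrix (Fin 3) (Fin 3) ℂ) i i -
                    ((t : Matrix.specialUnitaryGroup (Fin 3) ℂ) : Matrix (Fin 3) (Fin 3) ℂ) j j‖) /
                  (Fintype.card (Fin 3)).factorial)).toReal •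
              F (((t : specialDiagonalTorus (Fin 3)) : Matrix.specialUnitaryGroup (Fin 3) ℂ) :
                Matrix (Fin 3) (Fin 3) ℂ) ∂(haarProbability (specialDiagonalTorus (Fin 3))) :=
          integral_withDensity_eq_integral_toReal_smul measurable_vandermondeWeight_special
            (Filter.Eventually.of_forall fun _ => ENNReal.ofReal_lt_top) _
      _ = ∫ t, K (((t : specialDiagonalTorus (Fin 3)) : Matrix.specialUnitaryGroup (Fin 3) ℂ) :
            Matrix (Fin 3) (Fin 3) ℂ) ∂(haarProbability (specialDiagonalTorus (Fin 3))) := by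
          congr 1
          funext t
          rw [ENNReal.toReal_ofReal (div_nonneg (hV0 _) (by positivity)), smul_eq_mul, hK]
          simp only [hV, Fintype.card_fin, Nat.factorial, Nat.succ_eq_add_one, Nat.reduceAdd, Nat.reduceMul,
            Nat.cast_ofNat, mul_one]
  rw [hstep, integral_haar_su3Torus_eq_integral2 K hKc]
  -- shift to `[0, 2π]²`, evaluate the Vandermonde weight on the torus
  rw [integral2_periodic_shift (P := fun θ₁ θ₂ => K (Matrix.diagonal ![Complex.exp ((θ₁ : ℂ) * Complex.I),
      Complex.exp ((θ₂ : ℂ) * Complex.I), Complex.exp (((-(θ₁ + θ₂) : ℝ) : ℂ) * Complex.I)]))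
      (fun θ₂ θ₁ => by simp only [su3Diag_periodic_left])
      (fun θ₁ θ₂ => by simp only [su3Diag_periodic_right])]
  have hKval : ∀ θ₁ θ₂ : ℝ, K (Matrix.diagonal ![Complex.exp ((θ₁ : ℂ) * Complex.I),
      Complex.exp ((θ₂ : ℂ) * Complex.I), Complex.exp (((-(θ₁ + θ₂) : ℝ) : ℂ) * Complex.I)])
      = 1 / 6 * (F (Matrix.diagonal ![Complex.exp ((θ₁ : ℂ) * Complex.I), Complex.exp ((θ₂ : ℂ) * Complex.I),
          Complex.exp (((-(θ₁ + θ₂) : ℝ) : ℂ) * Complex.I)]) * weylSU3 θ₁ θ₂) := by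
    intro θ₁ θ₂
    simp only [hK, hV, Matrix.diagonal_apply_eq]
    rw [vandermonde_su3Diag_eq_weylSU3]
    ring
  simp_rw [hKval]
  rw [integral2_const_mul]
  ring

/-- **Trace class functions**: conditionally on Weyl's formula for `SU(3)`, for continuous `g`,
`∫_{SU(3)} g(Re tr U) dU = (1/(6(2π)²)) ∫_0^{2π}∫_0^{2π} g(Re tr U(θ)) |Δ|²(θ) dθ₂ dθ₁`,
`Re tr U(θ) = cos θ₁ + cos θ₂ + cos(θ₁ + θ₂) = reTrSU3 θ₁ θ₂`. -/
theorem integral_haar_su3_traceFun_eq_integral2 (hW : weylIntegralFormula_specialUnitary (Fin 3))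
    (g : ℝ → ℝ) (hg : Continuous g) :
    ∫ U, g ((U : Matrix.specialUnitaryGroup (Fin 3) ℂ) : Matrix (Fin 3) (Fin 3) ℂ).trace.re
        ∂(haarProbability (Matrix.specialUnitaryGroup (Fin 3) ℂ))
      = 1 / (6 * (2 * π) ^ 2) * ∫ θ₁ in (0 : ℝ)..2 * π, ∫ θ₂ in (0 : ℝ)..2 * π,
          g (reTrSU3 θ₁ θ₂) * weylSU3 θ₁ θ₂ := by
  have hcl : ∀ h U : Matrix.specialUnitaryGroup (Fin 3) ℂ,
      (fun M : Matrix (Fin 3) (Fin 3) ℂ => g M.trace.re)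
          (((h * U * h⁻¹ : Matrix.specialUnitaryGroup (Fin 3) ℂ)) : Matrix (Fin 3) (Fin 3) ℂ)
        = (fun M : Matrix (Fin 3) (Fin 3) ℂ => g M.trace.re)
          ((U : Matrix.specialUnitaryGroup (Fin 3) ℂ) : Matrix (Fin 3) (Fin 3) ℂ) := by
    intro h U
    simp only
    congr 2
    have hh : star (h : Matrix (Fin 3) (Fin 3) ℂ) * (h : Matrix (Fin 3) (Fin 3) ℂ) = 1 :=
      Matrix.mem_unitaryGroup_iff'.mp (Matrix.specialUnitaryGroup_le_unitaryGroup h.2)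
    rw [show (((h * U * h⁻¹ : Matrix.specialUnitaryGroup (Fin 3) ℂ)) : Matrix (Fin 3) (Fin 3) ℂ)
        = (h : Matrix (Fin 3) (Fin 3) ℂ) * (U : Matrix (Fin 3) (Fin 3) ℂ) * star (h : Matrix (Fin 3) (Fin 3) ℂ)
        from rfl, Matrix.trace_mul_cycle, hh, one_mul]
  have h := integral_haar_su3_classFun_eq_integral2 hW (fun M => g M.trace.re)
    (hg.comp (Complex.continuous_re.comp (continuous_id.matrix_trace))) hcl
  simp only [trace_re_su3Diag] at h
  exact h

/-! ### 5. theory-2's SU(3) one-plaquette integral and plaquette, conditionally on Weyl's formula -/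

/-- **theory-2's SU(3) one-plaquette integral is the Weyl-torus `Z₃`**: conditionally on Weyl's formula,
`z₁(β) = ∫ e^{−β(3 − Re tr U)} dU = e^{−3β} Z₃(3β) / (6(2π)²)` (dictionary: theory-2's weight
`e^{−β(N − Re tr U)}` is the table's `e^{(β'/3) Re tr U}` at `β' = 3β`). -/
theorem z1_su3_eq_onePlaquetteZSU3 (hW : weylIntegralFormula_specialUnitary (Fin 3)) (β : ℝ) :
    Theory2.Lattice.z1 (fundamentalRep (Fin 3)) β
      = ENNReal.ofReal (Real.exp (-(3 * β)) / (6 * (2 * π) ^ 2) * onePlaquetteZSU3 (3 * β)) := by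
  unfold Theory2.Lattice.z1
  have hc : Continuous fun U : Matrix.specialUnitaryGroup (Fin 3) ℂ =>
      Real.exp (-(β * ((3 : ℕ) - ((fundamentalRep (Fin 3) U).trace).re))) := by
    have : Continuous fun U : Matrix.specialUnitaryGroup (Fin 3) ℂ =>
        ((U : Matrix (Fin 3) (Fin 3) ℂ).trace).re :=
      Complex.continuous_re.comp (continuous_subtype_val.matrix_trace)
    simp only [fundamentalRep_apply]
    fun_prop
  rw [← ofReal_integral_eq_lintegral_ofReal
    (hc.integrable_of_hasCompactSupport (HasCompactSupport.of_compactSpace _))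
    (Filter.Eventually.of_forall fun U => (Real.exp_pos _).le)]
  congr 1
  simp only [fundamentalRep_apply, Nat.cast_ofNat]
  rw [integral_haar_su3_traceFun_eq_integral2 hW (fun t => Real.exp (-(β * (3 - t)))) (by fun_prop),
    onePlaquetteZSU3]
  have hpt : ∀ θ₁ θ₂ : ℝ, Real.exp (-(β * (3 - reTrSU3 θ₁ θ₂))) * weylSU3 θ₁ θ₂
      = Real.exp (-(3 * β)) * (weylSU3 θ₁ θ₂ * Real.exp (3 * β / 3 * reTrSU3 θ₁ θ₂)) := by
    intro θ₁ θ₂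
    rw [show -(β * (3 - reTrSU3 θ₁ θ₂)) = -(3 * β) + 3 * β / 3 * reTrSU3 θ₁ θ₂ by ring, Real.exp_add]
    ring
  simp_rw [hpt]
  rw [integral2_const_mul]
  ring

/-- **theory-2's SU(3) one-plaquette integral in Bessel form** (conditionally on Weyl's formula):
`z₁(β) = e^{−3β} Σ_{q ∈ ℤ} det[I_{|q+i−j|}(β)]_{i,j<3}` — the SU(3) sibling of GEN-9's
`z1_su2_eq_besselI` (`z₁^{SU(2)}(β) = e^{−2β}(I₀ − I₂)(2β)`), by `OnePlaquetteSU3Bessel`. -/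
theorem z1_su3_eq_tsum_det (hW : weylIntegralFormula_specialUnitary (Fin 3)) (β : ℝ) :
    Theory2.Lattice.z1 (fundamentalRep (Fin 3)) β
      = ENNReal.ofReal (Real.exp (-(3 * β)) * ∑' q : ℤ,
          (Matrix.of fun i j : Fin 3 => besselI (q + (i : ℕ) - (j : ℕ)).natAbs β).det) := by
  rw [z1_su3_eq_onePlaquetteZSU3 hW, onePlaquetteZSU3_eq_tsum_det, mul_div_cancel_left₀ β three_ne_zero]
  congr 1
  field_simp

/-- **The Haar one-plaquette law of SU(3) is the Weyl-torus law** (conditionally on Weyl's formula):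
for continuous `f`,
`∫ f(Re tr U) e^{−β(3 − Re tr U)} dU / ∫ e^{−β(3 − Re tr U)} dU = ⟨f(3·plaq)⟩` i.e.
`= onePlaquetteExpectSU3 (3β) (f ∘ reTrSU3)`. -/
theorem haar_su3_expect_eq_onePlaquetteExpectSU3 (hW : weylIntegralFormula_specialUnitary (Fin 3))
    (β : ℝ) (f : ℝ → ℝ) (hf : Continuous f) :
    (∫ U, f ((U : Matrix.specialUnitaryGroup (Fin 3) ℂ) : Matrix (Fin 3) (Fin 3) ℂ).trace.re
          * Real.exp (-(β * (3 - ((U : Matrix.specialUnitaryGroup (Fin 3) ℂ) : Matrix (Fin 3) (Fin 3) ℂ).trace.re)))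
        ∂(haarProbability (Matrix.specialUnitaryGroup (Fin 3) ℂ)))
      / (∫ U, Real.exp (-(β * (3 - ((U : Matrix.specialUnitaryGroup (Fin 3) ℂ) : Matrix (Fin 3) (Fin 3) ℂ).trace.re)))
        ∂(haarProbability (Matrix.specialUnitaryGroup (Fin 3) ℂ)))
      = onePlaquetteExpectSU3 (3 * β) (fun θ₁ θ₂ => f (reTrSU3 θ₁ θ₂)) := by
  rw [integral_haar_su3_traceFun_eq_integral2 hW (fun t => f t * Real.exp (-(β * (3 - t)))) (by fun_prop),
    integral_haar_su3_traceFun_eq_integral2 hW (fun t => Real.exp (-(β * (3 - t)))) (by fun_prop),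
    onePlaquetteExpectSU3, onePlaquetteZSU3]
  have hn : ∀ θ₁ θ₂ : ℝ, f (reTrSU3 θ₁ θ₂) * Real.exp (-(β * (3 - reTrSU3 θ₁ θ₂))) * weylSU3 θ₁ θ₂
      = Real.exp (-(3 * β)) * (f (reTrSU3 θ₁ θ₂)
          * (weylSU3 θ₁ θ₂ * Real.exp (3 * β / 3 * reTrSU3 θ₁ θ₂))) := by
    intro θ₁ θ₂
    rw [show -(β * (3 - reTrSU3 θ₁ θ₂)) = -(3 * β) + 3 * β / 3 * reTrSU3 θ₁ θ₂ by ring, Real.exp_add]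
    ring
  have hd : ∀ θ₁ θ₂ : ℝ, Real.exp (-(β * (3 - reTrSU3 θ₁ θ₂))) * weylSU3 θ₁ θ₂
      = Real.exp (-(3 * β)) * (weylSU3 θ₁ θ₂ * Real.exp (3 * β / 3 * reTrSU3 θ₁ θ₂)) := by
    intro θ₁ θ₂
    rw [show -(β * (3 - reTrSU3 θ₁ θ₂)) = -(3 * β) + 3 * β / 3 * reTrSU3 θ₁ θ₂ by ring, Real.exp_add]
    ring
  simp_rw [hn, hd]
  rw [integral2_const_mul, integral2_const_mul]
  have h1 : (1 / (6 * (2 * π) ^ 2) : ℝ) ≠ 0 := by positivity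
  have h2 : Real.exp (-(3 * β)) ≠ 0 := (Real.exp_pos _).ne'
  rw [mul_div_mul_left _ _ h1, mul_div_mul_left _ _ h2]

/-- **The SU(3) Haar plaquette `⟨(1/3) Re tr U_p⟩` is GEN-6's Weyl-torus plaquette** (conditionally on
Weyl's formula): `= onePlaquetteExpectSU3 (3β) plaqSU3`. -/
theorem haar_su3_plaquette_eq (hW : weylIntegralFormula_specialUnitary (Fin 3)) (β : ℝ) :
    (∫ U, ((U : Matrix.specialUnitaryGroup (Fin 3) ℂ) : Matrix (Fin 3) (Fin 3) ℂ).trace.re / 3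
          * Real.exp (-(β * (3 - ((U : Matrix.specialUnitaryGroup (Fin 3) ℂ) : Matrix (Fin 3) (Fin 3) ℂ).trace.re)))
        ∂(haarProbability (Matrix.specialUnitaryGroup (Fin 3) ℂ)))
      / (∫ U, Real.exp (-(β * (3 - ((U : Matrix.specialUnitaryGroup (Fin 3) ℂ) : Matrix (Fin 3) (Fin 3) ℂ).trace.re)))
        ∂(haarProbability (Matrix.specialUnitaryGroup (Fin 3) ℂ)))
      = onePlaquetteExpectSU3 (3 * β) plaqSU3 := by
  have h := haar_su3_expect_eq_onePlaquetteExpectSU3 hW β (fun t => t / 3) (by fun_prop)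
  rw [h]
  rfl

/-- **The cell's SU(3) enclosure, transported to the Haar measure** (conditionally on Weyl's formula):
at theory-2 coupling `β = 5/3` (table `β = 5`, the S0-C point),
`0.353954436705 ≤ ⟨(1/3) Re tr U_p⟩^{Haar}_{5/3} ≤ 0.353954436706` (GEN-6's `onePlaquetteExpectSU3_encl_5`). -/
theorem haar_su3_plaquette_encl_five_thirds (hW : weylIntegralFormula_specialUnitary (Fin 3)) :
    (353954436705 : ℝ) / 1000000000000 ≤
      (∫ U, ((U : Matrix.specialUnitaryGroup (Fin 3) ℂ) : Matrix (Fin 3) (Fin 3) ℂ).trace.re / 3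
          * Real.exp (-((5 / 3 : ℝ) * (3 - ((U : Matrix.specialUnitaryGroup (Fin 3) ℂ) :
              Matrix (Fin 3) (Fin 3) ℂ).trace.re)))
        ∂(haarProbability (Matrix.specialUnitaryGroup (Fin 3) ℂ)))
      / (∫ U, Real.exp (-((5 / 3 : ℝ) * (3 - ((U : Matrix.specialUnitaryGroup (Fin 3) ℂ) :
              Matrix (Fin 3) (Fin 3) ℂ).trace.re)))
        ∂(haarProbability (Matrix.specialUnitaryGroup (Fin 3) ℂ))) ∧
    (∫ U, ((U : Matrix.specialUnitaryGroup (Fin 3) ℂ) : Matrix (Fin 3) (Fin 3) ℂ).trace.re / 3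
          * Real.exp (-((5 / 3 : ℝ) * (3 - ((U : Matrix.specialUnitaryGroup (Fin 3) ℂ) :
              Matrix (Fin 3) (Fin 3) ℂ).trace.re)))
        ∂(haarProbability (Matrix.specialUnitaryGroup (Fin 3) ℂ)))
      / (∫ U, Real.exp (-((5 / 3 : ℝ) * (3 - ((U : Matrix.specialUnitaryGroup (Fin 3) ℂ) :
              Matrix (Fin 3) (Fin 3) ℂ).trace.re)))
        ∂(haarProbability (Matrix.specialUnitaryGroup (Fin 3) ℂ)))
      ≤ (353954436706 : ℝ) / 1000000000000 := by
  rw [haar_su3_plaquette_eq hW, show (3 : ℝ) * (5 / 3) = 5 by norm_num]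
  exact onePlaquetteExpectSU3_encl_5

/-- **The SU(3) Haar plaquette in Bessel–Toeplitz form** (conditionally on Weyl's formula; GEN-16's
`OnePlaquetteSU3PlaquetteBessel`): at theory-2 coupling `β` all Bessel arguments are `β`,
`⟨(1/3) Re tr U_p⟩^{Haar}_β = Σ_q Σ_{l<3} (det[I_{|q+i−j+[j=l]|}(β)] + det[I_{|q+i−j−[j=l]|}(β)]) / (6 Σ_q det[I_{|q+i−j|}(β)])`. -/
theorem haar_su3_plaquette_eq_tsum_det (hW : weylIntegralFormula_specialUnitary (Fin 3)) (β : ℝ) :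
    (∫ U, ((U : Matrix.specialUnitaryGroup (Fin 3) ℂ) : Matrix (Fin 3) (Fin 3) ℂ).trace.re / 3
          * Real.exp (-(β * (3 - ((U : Matrix.specialUnitaryGroup (Fin 3) ℂ) : Matrix (Fin 3) (Fin 3) ℂ).trace.re)))
        ∂(haarProbability (Matrix.specialUnitaryGroup (Fin 3) ℂ)))
      / (∫ U, Real.exp (-(β * (3 - ((U : Matrix.specialUnitaryGroup (Fin 3) ℂ) : Matrix (Fin 3) (Fin 3) ℂ).trace.re)))
        ∂(haarProbability (Matrix.specialUnitaryGroup (Fin 3) ℂ)))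
      = (∑' q : ℤ, ∑ l : Fin 3,
          ((Matrix.of fun i j : Fin 3 =>
              besselI (q + (i : ℕ) - (j : ℕ) + if j = l then 1 else 0).natAbs β).det
            + (Matrix.of fun i j : Fin 3 =>
              besselI (q + (i : ℕ) - (j : ℕ) - if j = l then 1 else 0).natAbs β).det))
        / (6 * ∑' q : ℤ, (Matrix.of fun i j : Fin 3 =>
            besselI (q + (i : ℕ) - (j : ℕ)).natAbs β).det) := by
  rw [haar_su3_plaquette_eq hW, onePlaquetteExpectSU3_plaqSU3_eq_tsum_det, mul_div_cancel_left₀ β three_ne_zero]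

/-- **The SU(3) Haar plaquette is non-decreasing in the coupling** (conditionally on Weyl's formula;
GEN-16's `OnePlaquetteSU3FreeEnergy.monotone_onePlaquetteExpectSU3_plaqSU3`: its `β`-derivative is the
plaquette variance). -/
theorem haar_su3_plaquette_monotone (hW : weylIntegralFormula_specialUnitary (Fin 3)) :
    Monotone fun β : ℝ =>
      (∫ U, ((U : Matrix.specialUnitaryGroup (Fin 3) ℂ) : Matrix (Fin 3) (Fin 3) ℂ).trace.re / 3
          * Real.exp (-(β * (3 - ((U : Matrix.specialUnitaryGroup (Fin 3) ℂ) : Matrix (Fin 3) (Fin 3) ℂ).trace.re)))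
        ∂(haarProbability (Matrix.specialUnitaryGroup (Fin 3) ℂ)))
      / (∫ U, Real.exp (-(β * (3 - ((U : Matrix.specialUnitaryGroup (Fin 3) ℂ) : Matrix (Fin 3) (Fin 3) ℂ).trace.re)))
        ∂(haarProbability (Matrix.specialUnitaryGroup (Fin 3) ℂ))) := by
  intro β β' h
  simp only [haar_su3_plaquette_eq hW]
  exact monotone_onePlaquetteExpectSU3_plaqSU3 (by linarith)

end Summit.Ventures.LatticeQCDFlow.Scoring
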